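import Summits.AtomisticToContinuum.Crystallization.Theorems.ExcessDecayLiouvilleHcpLiouvilleBlowdownRemainderPointwise
import Summits.AtomisticToContinuum.Crystallization.Theorems.ExcessDecayLiouvilleHcpLiouvilleBlowdownRemainderSum

/-!
# `ExcessDecayLiouville.HcpLiouville` (stmt-AtomisticToContinuum-9332), line `Sketch` (skeleton v4): stub `stub_remainder`, part 3

Closing file of stub `stub_remainder`: the interface `Blowdown.RemainderProp C` of the blow-down holds with an
explicit constant.  On top of `…BlowdownRemainderPointwise.lean` (pointwise bound `‖N(e,d)‖ ≤ 25000‖e‖⁻⁹‖d‖²`,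
part (i) `Blowdown.hasSum_linearised`) and `…BlowdownRemainderSum.lean` (NEAR and MID range sums):

* `Blowdown.remainder_far_sum_le` — FAR range `max (11/10) L₀ < dist p q`, `L₀ = (3R − 20)/10`: `‖w p − w q‖ ≤ 3/20`,
  the row `Σ_{dist ≥ ℓ} dist⁻⁸ ≤ 1024/((23/25)³ℓ⁵)` (`LevelOne.sum_far_le`), `#(S ∩ B_R) ≤ 32R³`
  (`LevelOne.card_sites_le`) and `ℓ ≥ R/20`: `≤ C · C_N · R⁻²`;
* `Blowdown.remainder_threeRange_sum_le` — NEAR + MID + FAR: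
  `Σ_{p ∈ S ∩ B_R} Σ_{q ∈ V} ‖N‖(1 + dist) ≤ K₁ C_N · nnEnergy S w c (4R) + K₂ C_N · R⁻²` for every finite `V`;
* `Blowdown.truncWeight_le` — `‖truncRemainder w c R p q‖(1 + dist) ≤ [p ∈ B_R] G(p,q) + [q ∈ B_R] G(q,p)`
  (antisymmetry `Blowdown.hcpLiouville_blowdown_vocabulary`), whence every finite partial sum over `S × S` is
  `≤ 2 (K₁ C_N · nnEnergy(4R) + K₂ C_N R⁻²)` (`Blowdown.sum_truncWeight_le`), which gives summability AND the `tsum`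
  bound (`summable_of_sum_le`, `Real.tsum_le_of_sum_le`) — `Blowdown.remainder_partII`;
* `stub_remainder` — `∃ C, Blowdown.RemainderProp C` at the anchored datum (`S* = Sites₀ (anchorDatum t τ) A`,
  `v = LevelOne.vField t A τ u`, `‖v p − v q‖ ≤ 3/20` by `LevelOne.norm_vField_sub_le`), `C_N = 25000`.

All `[folklore]`; a `--supports` helper for item stmt-AtomisticToContinuum-9332, nothing here closes an item.
-/

noncomputable section

namespace Summit.AtomisticToContinuum.Crystallization.Theorems.ExcessDecayLiouville

open scoped BigOperators Topology Classical InnerProductSpace RealInnerProductSpace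
open Literature.MathematicalPhysics.StatisticalMechanics
open Summit.AtomisticToContinuum.Crystallization.Theses.ExcessDecayLiouville
open Summit.AtomisticToContinuum.Crystallization.Theorems.PhononStabilityNegative

namespace Blowdown

open LevelOne

variable {t : Fin 2 → EuclideanSpace ℝ (Fin 3)} {A : EuclideanSpace ℝ (Fin 3) →L[ℝ] EuclideanSpace ℝ (Fin 3)}

/-! ## The FAR range sum -/

/-- **FAR sum**: for `R ≥ 1`, with `ℓ = max (11/10) ((3R − 20)/10) ≥ R/20`,
`Σ_{p ∈ S ∩ B_R} Σ_{q ∈ V} [ℓ < dist] ‖N‖(1 + dist) ≤ 32R³ · (9C_N/200) · 1024/((23/25)³ℓ⁵) ≤ C · C_N · R⁻²`.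
[folklore] -/
theorem remainder_far_sum_le {C_N : ℝ} (hC : 0 ≤ C_N)
    (hN : ∀ e d : EuclideanSpace ℝ (Fin 3), 23 / 25 ≤ ‖e‖ → ‖d‖ ≤ 3 / 20 →
      ‖ljRemainder e d‖ ≤ C_N * (‖e‖⁻¹) ^ 9 * ‖d‖ ^ 2)
    (hA : Adm₀ A) (hI : Inner₀ t A) {w : EuclideanSpace ℝ (Fin 3) → EuclideanSpace ℝ (Fin 3)}
    (hw : ∀ p ∈ Sites₀ t A, ∀ q ∈ Sites₀ t A, ‖w p - w q‖ ≤ 3 / 20)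
    (c : EuclideanSpace ℝ (Fin 3)) {R : ℝ} (hR : 1 ≤ R) (V : Finset (Sites₀ t A)) :
    ∑ p ∈ (finite_sites_ball hA hI c R).toFinset, ∑ q ∈ V,
        (if max (11 / 10) ((3 * R - 20) / 10) < dist (p : EuclideanSpace ℝ (Fin 3)) q then
          ‖ljRemainder ((p : EuclideanSpace ℝ (Fin 3)) - q) (w p - w q)‖ * (1 + dist (p : EuclideanSpace ℝ (Fin 3)) q)
        else (0 : ℝ)) ≤
      (32 * (9 / 200) * (1024 / (23 / 25) ^ 3) * 20 ^ 5) * C_N * (R⁻¹) ^ 2 := by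
  set ℓ : ℝ := max (11 / 10) ((3 * R - 20) / 10) with hℓ
  have hℓ1 : 11 / 10 ≤ ℓ := le_max_left _ _
  have hℓ0 : 0 < ℓ := by linarith
  have hR0 : 0 < R := by linarith
  have hRℓ : R / 20 ≤ ℓ := by
    rcases le_or_gt R 22 with h | h
    · exact le_trans (by linarith) (le_max_left _ _)
    · exact le_trans (by linarith) (le_max_right _ _)
  -- each row
  have hrow : ∀ p ∈ (finite_sites_ball hA hI c R).toFinset,
      ∑ q ∈ V, (if ℓ < dist (p : EuclideanSpace ℝ (Fin 3)) q then
          ‖ljRemainder ((p : EuclideanSpace ℝ (Fin 3)) - q) (w p - w q)‖ * (1 + dist (p : EuclideanSpace ℝ (Fin 3)) q)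
          else (0 : ℝ)) ≤ 9 * C_N / 200 * (1024 / ((23 / 25 : ℝ) ^ 3 * ℓ ^ 5)) := by
    intro p _
    have hfar := sum_far_le hA hI (p : EuclideanSpace ℝ (Fin 3)) (R := ℓ) (by linarith) (k := 5) (by norm_num) V
    calc ∑ q ∈ V, (if ℓ < dist (p : EuclideanSpace ℝ (Fin 3)) q then
          ‖ljRemainder ((p : EuclideanSpace ℝ (Fin 3)) - q) (w p - w q)‖ * (1 + dist (p : EuclideanSpace ℝ (Fin 3)) q)
          else (0 : ℝ))
        ≤ ∑ q ∈ V, 9 * C_N / 200 * (if ℓ ≤ dist (q : EuclideanSpace ℝ (Fin 3)) p then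
            (dist (q : EuclideanSpace ℝ (Fin 3)) p)⁻¹ ^ (5 + 3) else (0 : ℝ)) := by
          refine Finset.sum_le_sum fun q _ => ?_
          split_ifs with h1 h2
          · have h3 := remainder_far_le hC hN hA hI hw p.2 q.2 (lt_of_le_of_lt hℓ1 h1)
            rw [dist_comm (q : EuclideanSpace ℝ (Fin 3))]
            exact h3
          · exact (h2 (by rw [dist_comm]; exact h1.le)).elim
          · positivity
          · simp
      _ = 9 * C_N / 200 * ∑ q ∈ V, (if ℓ ≤ dist (q : EuclideanSpace ℝ (Fin 3)) p then
            (dist (q : EuclideanSpace ℝ (Fin 3)) p)⁻¹ ^ (5 + 3) else (0 : ℝ)) := by rw [Finset.mul_sum]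
      _ ≤ 9 * C_N / 200 * (1024 / ((23 / 25 : ℝ) ^ 3 * ℓ ^ 5)) :=
          mul_le_mul_of_nonneg_left hfar (by positivity)
  -- count the rows
  have hcard : (((finite_sites_ball hA hI c R).toFinset.card : ℕ) : ℝ) ≤ 32 * R ^ 3 :=
    card_sites_le hA hI c hR _ fun q hq => (mem_ballFinset hA hI).1 hq
  -- `ℓ⁻⁵ ≤ 20⁵ R⁻⁵`
  have hℓ5 : (ℓ ^ 5)⁻¹ ≤ 20 ^ 5 * (R⁻¹) ^ 5 := by
    have h1 : (R / 20) ^ 5 ≤ ℓ ^ 5 := pow_le_pow_left₀ (by positivity) hRℓ 5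
    have h2 : 0 < (R / 20) ^ 5 := by positivity
    calc (ℓ ^ 5)⁻¹ ≤ ((R / 20) ^ 5)⁻¹ := inv_anti₀ h2 h1
      _ = 20 ^ 5 * (R⁻¹) ^ 5 := by rw [div_pow, inv_div, inv_pow, div_eq_mul_inv]
  have hR35 : R ^ 3 * (R⁻¹) ^ 5 = (R⁻¹) ^ 2 := by
    field_simp
  calc ∑ p ∈ (finite_sites_ball hA hI c R).toFinset, ∑ q ∈ V,
        (if ℓ < dist (p : EuclideanSpace ℝ (Fin 3)) q then
          ‖ljRemainder ((p : EuclideanSpace ℝ (Fin 3)) - q) (w p - w q)‖ * (1 + dist (p : EuclideanSpace ℝ (Fin 3)) q)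
          else (0 : ℝ))
      ≤ ∑ p ∈ (finite_sites_ball hA hI c R).toFinset, 9 * C_N / 200 * (1024 / ((23 / 25 : ℝ) ^ 3 * ℓ ^ 5)) :=
        Finset.sum_le_sum hrow
    _ = ((finite_sites_ball hA hI c R).toFinset.card : ℝ) * (9 * C_N / 200 * (1024 / ((23 / 25 : ℝ) ^ 3 * ℓ ^ 5))) := by
        rw [Finset.sum_const, nsmul_eq_mul]
    _ ≤ (32 * R ^ 3) * (9 * C_N / 200 * (1024 / ((23 / 25 : ℝ) ^ 3 * ℓ ^ 5))) :=
        mul_le_mul_of_nonneg_right hcard (by positivity)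
    _ = (32 * (9 / 200) * (1024 / (23 / 25) ^ 3)) * C_N * (R ^ 3 * (ℓ ^ 5)⁻¹) := by ring
    _ ≤ (32 * (9 / 200) * (1024 / (23 / 25) ^ 3)) * C_N * (R ^ 3 * (20 ^ 5 * (R⁻¹) ^ 5)) := by
        have h0 : 0 ≤ (32 * (9 / 200) * (1024 / (23 / 25) ^ 3)) * C_N := by positivity
        refine mul_le_mul_of_nonneg_left ?_ h0
        exact mul_le_mul_of_nonneg_left hℓ5 (by positivity)
    _ = (32 * (9 / 200) * (1024 / (23 / 25) ^ 3) * 20 ^ 5) * C_N * (R ^ 3 * (R⁻¹) ^ 5) := by ring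
    _ = _ := by rw [hR35]

/-! ## Assembly of the three ranges -/

/-- Splitting a real number along the three ranges of a distance. [folklore] -/
theorem split_threeRange (a d L : ℝ) :
    a = (if d ≤ 11 / 10 then a else 0) + (if 11 / 10 < d ∧ d ≤ L then a else 0) +
      (if max (11 / 10) L < d then a else 0) := by
  by_cases h1 : d ≤ 11 / 10
  · rw [if_pos h1, if_neg (fun h => absurd h.1 (not_lt.2 h1)),
      if_neg (fun h => absurd (lt_of_le_of_lt (le_max_left _ _) h) (not_lt.2 h1))]
    ring
  · by_cases h2 : d ≤ L
    · rw [if_neg h1, if_pos ⟨not_le.1 h1, h2⟩,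
        if_neg (fun h => absurd (lt_of_le_of_lt (le_max_right _ _) h) (not_lt.2 h2))]
      ring
    · rw [if_neg h1, if_neg (fun h => h2 h.2), if_pos (max_lt (not_le.1 h1) (not_le.1 h2))]
      ring

/-- **The three-range estimate** (NEAR + MID + FAR): for `R ≥ 1` and every finite set `V` of sites,
`Σ_{p ∈ S ∩ B_R} Σ_{q ∈ V} ‖N(p − q, w p − w q)‖(1 + dist p q) ≤
(5 + 8·10⁶) C_N · nnEnergy S w c (4R) + (32 · 9/200 · 1024/(23/25)³ · 20⁵) C_N · R⁻²`. [folklore] -/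
theorem remainder_threeRange_sum_le {C_N : ℝ} (hC : 0 ≤ C_N)
    (hN : ∀ e d : EuclideanSpace ℝ (Fin 3), 23 / 25 ≤ ‖e‖ → ‖d‖ ≤ 3 / 20 →
      ‖ljRemainder e d‖ ≤ C_N * (‖e‖⁻¹) ^ 9 * ‖d‖ ^ 2)
    (hA : Adm₀ A) (hI : Inner₀ t A) {w : EuclideanSpace ℝ (Fin 3) → EuclideanSpace ℝ (Fin 3)}
    (hw : ∀ p ∈ Sites₀ t A, ∀ q ∈ Sites₀ t A, ‖w p - w q‖ ≤ 3 / 20)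
    (c : EuclideanSpace ℝ (Fin 3)) {R : ℝ} (hR : 1 ≤ R) (V : Finset (Sites₀ t A)) :
    ∑ p ∈ (finite_sites_ball hA hI c R).toFinset, ∑ q ∈ V,
        ‖ljRemainder ((p : EuclideanSpace ℝ (Fin 3)) - q) (w p - w q)‖ * (1 + dist (p : EuclideanSpace ℝ (Fin 3)) q) ≤
      (5 + 8000000) * C_N * nnEnergy (Sites₀ t A) w c (4 * R) +
        (32 * (9 / 200) * (1024 / (23 / 25) ^ 3) * 20 ^ 5) * C_N * (R⁻¹) ^ 2 := by
  have hnear := remainder_near_sum_le hC hN hA hI hw c R V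
  have hmid := remainder_mid_sum_le hC hN hA hI hw c R V
  have hfar := remainder_far_sum_le hC hN hA hI hw c hR V
  have hmono : nnEnergy (Sites₀ t A) w c R ≤ nnEnergy (Sites₀ t A) w c (4 * R) :=
    nnEnergy_le_of_le hA hI w c (by linarith)
  have hsplit : ∑ p ∈ (finite_sites_ball hA hI c R).toFinset, ∑ q ∈ V,
      ‖ljRemainder ((p : EuclideanSpace ℝ (Fin 3)) - q) (w p - w q)‖ * (1 + dist (p : EuclideanSpace ℝ (Fin 3)) q) =
      ∑ p ∈ (finite_sites_ball hA hI c R).toFinset, ∑ q ∈ V,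
        (if dist (p : EuclideanSpace ℝ (Fin 3)) q ≤ 11 / 10 then
          ‖ljRemainder ((p : EuclideanSpace ℝ (Fin 3)) - q) (w p - w q)‖ * (1 + dist (p : EuclideanSpace ℝ (Fin 3)) q)
          else (0 : ℝ)) +
      ∑ p ∈ (finite_sites_ball hA hI c R).toFinset, ∑ q ∈ V,
        (if 11 / 10 < dist (p : EuclideanSpace ℝ (Fin 3)) q ∧ dist (p : EuclideanSpace ℝ (Fin 3)) q ≤ (3 * R - 20) / 10 then
          ‖ljRemainder ((p : EuclideanSpace ℝ (Fin 3)) - q) (w p - w q)‖ * (1 + dist (p : EuclideanSpace ℝ (Fin 3)) q)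
          else (0 : ℝ)) +
      ∑ p ∈ (finite_sites_ball hA hI c R).toFinset, ∑ q ∈ V,
        (if max (11 / 10) ((3 * R - 20) / 10) < dist (p : EuclideanSpace ℝ (Fin 3)) q then
          ‖ljRemainder ((p : EuclideanSpace ℝ (Fin 3)) - q) (w p - w q)‖ * (1 + dist (p : EuclideanSpace ℝ (Fin 3)) q)
          else (0 : ℝ)) := by
    rw [← Finset.sum_add_distrib, ← Finset.sum_add_distrib]
    refine Finset.sum_congr rfl fun p _ => ?_
    rw [← Finset.sum_add_distrib, ← Finset.sum_add_distrib]
    refine Finset.sum_congr rfl fun q _ => ?_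
    exact split_threeRange _ _ _
  rw [hsplit]
  have h5 : 0 ≤ 5 * C_N := by positivity
  calc _ ≤ 5 * C_N * nnEnergy (Sites₀ t A) w c R + 8000000 * C_N * nnEnergy (Sites₀ t A) w c (4 * R) +
        (32 * (9 / 200) * (1024 / (23 / 25) ^ 3) * 20 ^ 5) * C_N * (R⁻¹) ^ 2 :=
      add_le_add (add_le_add hnear hmid) hfar
    _ ≤ 5 * C_N * nnEnergy (Sites₀ t A) w c (4 * R) + 8000000 * C_N * nnEnergy (Sites₀ t A) w c (4 * R) +
        (32 * (9 / 200) * (1024 / (23 / 25) ^ 3) * 20 ^ 5) * C_N * (R⁻¹) ^ 2 := by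
      have := mul_le_mul_of_nonneg_left hmono h5
      linarith
    _ = _ := by ring


/-! ## The truncated remainder: finite partial sums over `S × S`, summability, the `tsum` bound -/

/-- **Domination of the weighted truncated remainder**:
`‖truncRemainder w c R p q‖(1 + dist p q) ≤ [dist p c ≤ R] G(p,q) + [dist q c ≤ R] G(q,p)` with
`G(p,q) = ‖N(p − q, w p − w q)‖(1 + dist p q)` (antisymmetry of the truncated remainder for the second case).
[folklore] -/
theorem truncWeight_le (w : EuclideanSpace ℝ (Fin 3) → EuclideanSpace ℝ (Fin 3)) (c : EuclideanSpace ℝ (Fin 3)) (R : ℝ)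
    (p q : EuclideanSpace ℝ (Fin 3)) :
    ‖truncRemainder w c R p q‖ * (1 + dist p q) ≤
      (if dist p c ≤ R then ‖ljRemainder (p - q) (w p - w q)‖ * (1 + dist p q) else 0) +
        (if dist q c ≤ R then ‖ljRemainder (q - p) (w q - w p)‖ * (1 + dist q p) else 0) := by
  by_cases hp : dist p c ≤ R
  · rw [truncRemainder_of_dist_le w hp, if_pos hp]
    have h0 : 0 ≤ (if dist q c ≤ R then ‖ljRemainder (q - p) (w q - w p)‖ * (1 + dist q p) else 0) := by
      split_ifs <;> positivity
    linarith
  · by_cases hq : dist q c ≤ R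
    · rw [hcpLiouville_blowdown_vocabulary w c R q p, norm_neg, truncRemainder_of_dist_le w hq, if_neg hp, if_pos hq,
        zero_add, dist_comm p q]
    · have h0 : truncRemainder w c R p q = 0 := by simp [truncRemainder, hp, hq]
      rw [h0, norm_zero, zero_mul, if_neg hp, if_neg hq, add_zero]

/-- Rows off the ball drop out: `Σ_{p ∈ W} Σ_{q ∈ V} [dist p c ≤ R] G(p,q) ≤ Σ_{p ∈ S ∩ B_R} Σ_{q ∈ V} G(p,q)`. [folklore] -/
theorem sum_ite_ball_le (hA : Adm₀ A) (hI : Inner₀ t A) (G : Sites₀ t A → Sites₀ t A → ℝ) (hG : ∀ p q, 0 ≤ G p q)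
    (c : EuclideanSpace ℝ (Fin 3)) (R : ℝ) (W V : Finset (Sites₀ t A)) :
    ∑ p ∈ W, ∑ q ∈ V, (if dist (p : EuclideanSpace ℝ (Fin 3)) c ≤ R then G p q else 0) ≤
      ∑ p ∈ (finite_sites_ball hA hI c R).toFinset, ∑ q ∈ V, G p q := by
  calc ∑ p ∈ W, ∑ q ∈ V, (if dist (p : EuclideanSpace ℝ (Fin 3)) c ≤ R then G p q else 0)
      = ∑ p ∈ W, (if dist (p : EuclideanSpace ℝ (Fin 3)) c ≤ R then ∑ q ∈ V, G p q else 0) :=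
        Finset.sum_congr rfl fun p _ => by
          by_cases h : dist (p : EuclideanSpace ℝ (Fin 3)) c ≤ R <;> simp [h]
    _ = ∑ p ∈ W.filter (fun p : Sites₀ t A => dist (p : EuclideanSpace ℝ (Fin 3)) c ≤ R), ∑ q ∈ V, G p q :=
        (Finset.sum_filter _ _).symm
    _ ≤ ∑ p ∈ (finite_sites_ball hA hI c R).toFinset, ∑ q ∈ V, G p q :=
        Finset.sum_le_sum_of_subset_of_nonneg
          (fun p hp => (mem_ballFinset hA hI).2 (Finset.mem_filter.1 hp).2)
          (fun p _ _ => Finset.sum_nonneg fun q _ => hG p q)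

/-- **Finite partial sums of the weighted truncated remainder over `S × S`** are bounded by twice the three-range
estimate (the pairs with `p ∈ B_R` and, by antisymmetry, those with `q ∈ B_R`). [folklore] -/
theorem sum_truncWeight_le {C_N : ℝ} (hC : 0 ≤ C_N)
    (hN : ∀ e d : EuclideanSpace ℝ (Fin 3), 23 / 25 ≤ ‖e‖ → ‖d‖ ≤ 3 / 20 →
      ‖ljRemainder e d‖ ≤ C_N * (‖e‖⁻¹) ^ 9 * ‖d‖ ^ 2)
    (hA : Adm₀ A) (hI : Inner₀ t A) {w : EuclideanSpace ℝ (Fin 3) → EuclideanSpace ℝ (Fin 3)}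
    (hw : ∀ p ∈ Sites₀ t A, ∀ q ∈ Sites₀ t A, ‖w p - w q‖ ≤ 3 / 20)
    (c : EuclideanSpace ℝ (Fin 3)) {R : ℝ} (hR : 1 ≤ R) (U : Finset (Sites₀ t A × Sites₀ t A)) :
    ∑ x ∈ U, ‖truncRemainder w c R x.1 x.2‖ * (1 + dist (x.1 : EuclideanSpace ℝ (Fin 3)) x.2) ≤
      2 * ((5 + 8000000) * C_N * nnEnergy (Sites₀ t A) w c (4 * R) +
        (32 * (9 / 200) * (1024 / (23 / 25) ^ 3) * 20 ^ 5) * C_N * (R⁻¹) ^ 2) := by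
  have hG0 : ∀ p q : Sites₀ t A,
      0 ≤ ‖ljRemainder ((p : EuclideanSpace ℝ (Fin 3)) - q) (w p - w q)‖ * (1 + dist (p : EuclideanSpace ℝ (Fin 3)) q) :=
    fun p q => by positivity
  have hK1 := remainder_threeRange_sum_le hC hN hA hI hw c hR (U.image Prod.snd)
  have hK2 := remainder_threeRange_sum_le hC hN hA hI hw c hR (U.image Prod.fst)
  have h1 := sum_ite_ball_le hA hI (fun p q : Sites₀ t A =>
    ‖ljRemainder ((p : EuclideanSpace ℝ (Fin 3)) - q) (w p - w q)‖ * (1 + dist (p : EuclideanSpace ℝ (Fin 3)) q))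
    hG0 c R (U.image Prod.fst) (U.image Prod.snd)
  have h2 := sum_ite_ball_le hA hI (fun p q : Sites₀ t A =>
    ‖ljRemainder ((p : EuclideanSpace ℝ (Fin 3)) - q) (w p - w q)‖ * (1 + dist (p : EuclideanSpace ℝ (Fin 3)) q))
    hG0 c R (U.image Prod.snd) (U.image Prod.fst)
  calc ∑ x ∈ U, ‖truncRemainder w c R x.1 x.2‖ * (1 + dist (x.1 : EuclideanSpace ℝ (Fin 3)) x.2)
      ≤ ∑ x ∈ U, ((if dist (x.1 : EuclideanSpace ℝ (Fin 3)) c ≤ R then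
            ‖ljRemainder ((x.1 : EuclideanSpace ℝ (Fin 3)) - x.2) (w x.1 - w x.2)‖ *
              (1 + dist (x.1 : EuclideanSpace ℝ (Fin 3)) x.2) else 0) +
          (if dist (x.2 : EuclideanSpace ℝ (Fin 3)) c ≤ R then
            ‖ljRemainder ((x.2 : EuclideanSpace ℝ (Fin 3)) - x.1) (w x.2 - w x.1)‖ *
              (1 + dist (x.2 : EuclideanSpace ℝ (Fin 3)) x.1) else 0)) :=
        Finset.sum_le_sum fun x _ => truncWeight_le w c R x.1 x.2
    _ ≤ ∑ x ∈ U.image Prod.fst ×ˢ U.image Prod.snd, ((if dist (x.1 : EuclideanSpace ℝ (Fin 3)) c ≤ R then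
            ‖ljRemainder ((x.1 : EuclideanSpace ℝ (Fin 3)) - x.2) (w x.1 - w x.2)‖ *
              (1 + dist (x.1 : EuclideanSpace ℝ (Fin 3)) x.2) else 0) +
          (if dist (x.2 : EuclideanSpace ℝ (Fin 3)) c ≤ R then
            ‖ljRemainder ((x.2 : EuclideanSpace ℝ (Fin 3)) - x.1) (w x.2 - w x.1)‖ *
              (1 + dist (x.2 : EuclideanSpace ℝ (Fin 3)) x.1) else 0)) :=
        Finset.sum_le_sum_of_subset_of_nonneg Finset.subset_product fun x _ _ => by positivity
    _ = ∑ p ∈ U.image Prod.fst, ∑ q ∈ U.image Prod.snd, (if dist (p : EuclideanSpace ℝ (Fin 3)) c ≤ R then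
            ‖ljRemainder ((p : EuclideanSpace ℝ (Fin 3)) - q) (w p - w q)‖ * (1 + dist (p : EuclideanSpace ℝ (Fin 3)) q)
            else 0) +
          ∑ q ∈ U.image Prod.snd, ∑ p ∈ U.image Prod.fst, (if dist (q : EuclideanSpace ℝ (Fin 3)) c ≤ R then
            ‖ljRemainder ((q : EuclideanSpace ℝ (Fin 3)) - p) (w q - w p)‖ * (1 + dist (q : EuclideanSpace ℝ (Fin 3)) p)
            else 0) := by
        rw [Finset.sum_add_distrib, Finset.sum_product, Finset.sum_product_right]
    _ ≤ ∑ p ∈ (finite_sites_ball hA hI c R).toFinset, ∑ q ∈ U.image Prod.snd,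
            ‖ljRemainder ((p : EuclideanSpace ℝ (Fin 3)) - q) (w p - w q)‖ * (1 + dist (p : EuclideanSpace ℝ (Fin 3)) q) +
          ∑ p ∈ (finite_sites_ball hA hI c R).toFinset, ∑ q ∈ U.image Prod.fst,
            ‖ljRemainder ((p : EuclideanSpace ℝ (Fin 3)) - q) (w p - w q)‖ * (1 + dist (p : EuclideanSpace ℝ (Fin 3)) q) :=
        add_le_add h1 h2
    _ ≤ _ := add_le_add hK1 hK2
    _ = _ := by ring

/-- **Part (ii) of `RemainderProp` for a general admissible datum**: the weighted truncated remainder is summable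
over `S × S` and its sum is `≤ 2 (K₁ C_N · nnEnergy S w c (4R) + K₂ C_N · R⁻²)`. [folklore] -/
theorem remainder_partII {C_N : ℝ} (hC : 0 ≤ C_N)
    (hN : ∀ e d : EuclideanSpace ℝ (Fin 3), 23 / 25 ≤ ‖e‖ → ‖d‖ ≤ 3 / 20 →
      ‖ljRemainder e d‖ ≤ C_N * (‖e‖⁻¹) ^ 9 * ‖d‖ ^ 2)
    (hA : Adm₀ A) (hI : Inner₀ t A) {w : EuclideanSpace ℝ (Fin 3) → EuclideanSpace ℝ (Fin 3)}
    (hw : ∀ p ∈ Sites₀ t A, ∀ q ∈ Sites₀ t A, ‖w p - w q‖ ≤ 3 / 20)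
    (c : EuclideanSpace ℝ (Fin 3)) {R : ℝ} (hR : 1 ≤ R) :
    Summable (fun pq : Sites₀ t A × Sites₀ t A =>
        ‖truncRemainder w c R pq.1 pq.2‖ * (1 + dist (pq.1 : EuclideanSpace ℝ (Fin 3)) pq.2)) ∧
      (∑' pq : Sites₀ t A × Sites₀ t A,
        ‖truncRemainder w c R pq.1 pq.2‖ * (1 + dist (pq.1 : EuclideanSpace ℝ (Fin 3)) pq.2)) ≤
        2 * ((5 + 8000000) * C_N * nnEnergy (Sites₀ t A) w c (4 * R) +
          (32 * (9 / 200) * (1024 / (23 / 25) ^ 3) * 20 ^ 5) * C_N * (R⁻¹) ^ 2) := by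
  have hnn : 0 ≤ fun pq : Sites₀ t A × Sites₀ t A =>
      ‖truncRemainder w c R pq.1 pq.2‖ * (1 + dist (pq.1 : EuclideanSpace ℝ (Fin 3)) pq.2) :=
    fun pq => by positivity
  have hbd := fun U : Finset (Sites₀ t A × Sites₀ t A) => sum_truncWeight_le hC hN hA hI hw c hR U
  exact ⟨summable_of_sum_le hnn hbd, Real.tsum_le_of_sum_le hnn hbd⟩

end Blowdown

/-- **Stub `stub_remainder` of the skeleton v4** (crux stmt-AtomisticToContinuum-9332, line `Sketch`): the interface
`Blowdown.RemainderProp C` holds with `C = 2(K₁ + K₂)·25000`, `K₁ = 5 + 8·10⁶`,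
`K₂ = 32 · 9/200 · 1024/(23/25)³ · 20⁵`. [folklore] -/
theorem stub_remainder : ∃ C : ℝ, Blowdown.RemainderProp C := by
  refine ⟨2 * ((5 + 8000000) * 25000 + (32 * (9 / 200) * (1024 / (23 / 25) ^ 3) * 20 ^ 5) * 25000), ?_⟩
  intro X t A u τ hA hI hEX hu _ hIτ hEτ
  refine ⟨fun p => Blowdown.hasSum_linearised hA hI hIτ hu hEX hEτ p, fun c R hR => ?_⟩
  have hw : ∀ p ∈ Sites₀ (anchorDatum t τ) A, ∀ q ∈ Sites₀ (anchorDatum t τ) A,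
      ‖LevelOne.vField t A τ u p - LevelOne.vField t A τ u q‖ ≤ 3 / 20 :=
    fun p hp q hq => LevelOne.norm_vField_sub_le hA hI hIτ hu hp hq
  have hN : ∀ e d : EuclideanSpace ℝ (Fin 3), 23 / 25 ≤ ‖e‖ → ‖d‖ ≤ 3 / 20 →
      ‖Blowdown.ljRemainder e d‖ ≤ 25000 * (‖e‖⁻¹) ^ 9 * ‖d‖ ^ 2 :=
    fun e d he hd => Blowdown.norm_ljRemainder_le he hd
  obtain ⟨hs, hb⟩ := Blowdown.remainder_partII (by norm_num) hN hA hIτ hw c hR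
  refine ⟨hs, hb.trans ?_⟩
  have h1 := Blowdown.nnEnergy_nonneg (Sites₀ (anchorDatum t τ) A) (LevelOne.vField t A τ u) c (4 * R)
  have h2 : 0 ≤ (R⁻¹) ^ 2 := by positivity
  nlinarith

/-- Registered sub-goal carrying this file (crux stmt-AtomisticToContinuum-9332, line `Sketch`, skeleton v4,
stub `stub_remainder`, part 3): the three-range estimate of the weighted pair-force remainder over the sites of a ball,
against an arbitrary finite set of partner sites, for a field with differences `≤ 3/20` and a pointwise remainder
bound with constant `C_N`. [folklore] -/
theorem blowdown_remainderSum : ∀ (C_N : ℝ) (t : Fin 2 → EuclideanSpace ℝ (Fin 3))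
    (A : EuclideanSpace ℝ (Fin 3) →L[ℝ] EuclideanSpace ℝ (Fin 3))
    (w : EuclideanSpace ℝ (Fin 3) → EuclideanSpace ℝ (Fin 3)) (hA : Adm₀ A) (hI : Inner₀ t A), 0 ≤ C_N →
    (∀ e d : EuclideanSpace ℝ (Fin 3), 23 / 25 ≤ ‖e‖ → ‖d‖ ≤ 3 / 20 →
      ‖Blowdown.ljRemainder e d‖ ≤ C_N * (‖e‖⁻¹) ^ 9 * ‖d‖ ^ 2) →
    (∀ p ∈ Sites₀ t A, ∀ q ∈ Sites₀ t A, ‖w p - w q‖ ≤ 3 / 20) →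
    ∀ (c : EuclideanSpace ℝ (Fin 3)) (R : ℝ), 1 ≤ R → ∀ V : Finset (Sites₀ t A),
      ∑ p ∈ (LevelOne.finite_sites_ball hA hI c R).toFinset, ∑ q ∈ V,
          ‖Blowdown.ljRemainder ((p : EuclideanSpace ℝ (Fin 3)) - q) (w p - w q)‖ *
            (1 + dist (p : EuclideanSpace ℝ (Fin 3)) q) ≤
        (5 + 8000000) * C_N * Blowdown.nnEnergy (Sites₀ t A) w c (4 * R) +
          (32 * (9 / 200) * (1024 / (23 / 25) ^ 3) * 20 ^ 5) * C_N * (R⁻¹) ^ 2 :=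
  fun _ _ _ _ hA hI hC hN hw c _ hR V => Blowdown.remainder_threeRange_sum_le hC hN hA hI hw c hR V

end Summit.AtomisticToContinuum.Crystallization.Theorems.ExcessDecayLiouville

end
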